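import Summits.QuantumAdvantage.QuantumAdvantage.Theorems.WbwObfuscatedGluedTreesKowVocabulary
import Summits.QuantumAdvantage.QuantumAdvantage.Theorems.WbwObfuscatedGluedTreesKowFPExtension
import Summits.QuantumAdvantage.QuantumAdvantage.Theorems.WbwObfuscatedGluedTreesKowSeedLaw
import Summits.QuantumAdvantage.QuantumAdvantage.Theorems.WbwObfuscatedGluedTreesKowCoinNormalisation
import Literature.Computability.Complexity.BPPErrorReduction

/-!
# `WbwObfuscatedGluedTrees` (stmt-QuantumAdvantage-2340) — line `knowledge-of-walk-split`: the converse `(C) → WordHard`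

Support statement `ClauseCImpWordHard` of the skeleton (§6; requested by TRIAGE-r1-2: "state and land
`(C) → WordHard` next to the split, so the record shows KWA ⊢ ((C) ↔ WordHard)"), PROVED: if walk-words can be
evaluated in polynomial time from the instance (`ev ⟨⟨1ⁿ, gen s⟩, code of w⟩ = endpoint of w`, `[]` when the walk
is invalid) and the model is coherent, then clause (C) implies `WordHard` — a word finder composed with the
evaluator is an answer finder with at least the same success probability.
-/

set_option linter.dupNamespace false

noncomputable section

namespace Summit.QuantumAdvantage.QuantumAdvantage.Theorems.WbwObfuscatedGluedTrees.KnowledgeOfWalk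

open Literature.Computability.Cryptography Literature.Computability.Complexity
open _root_.Computability Brick Filter Asymptotics
open Summit.QuantumAdvantage.QuantumAdvantage.Theorems.WbwObfuscatedGluedTrees.Negative (ClauseC)

namespace Support

/-- The answer finder obtained from a word finder `W` and a word evaluator `ev`: evaluate the word.
[folklore] -/
def evalAlg (W : RandAlg (List Bool) (List ℕ)) (ev : List Bool → List Bool) : RandAlg (List Bool) (List Bool) where
  run z r := ev (boolPair z (encodingListNatBool.encode (W.run z r)))
  coinLen := W.coinLen

/-- The answer finder is PPT when `W` is PPT and `ev` is polynomial-time. [folklore] -/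
theorem isPPT_evalAlg {W : RandAlg (List Bool) (List ℕ)} (hW : IsPPT W encodingListNatBool.encode)
    {ev : List Bool → List Bool} (hev : PolyTimeComputable id id ev) : IsPPT (evalAlg W ev) id := by
  obtain ⟨R, hR, hRrun⟩ := FPExtension.exists_FP_extension hW.1
  obtain ⟨Ev, hEv, hEvrun⟩ := FPExtension.exists_FP_extension hev
  refine FPExtension.isPolyTime_of_FP (F := Ev ∘ fanoutFn fstF R) (comp_mem_FP hEv (fanoutFn_mem_FP fstF_mem_FP hR))
    (fun z r => ?_) hW.2
  have h1 : R (boolPair z r) = encodingListNatBool.encode (W.run z r) := hRrun (z, r)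
  have h2 : ∀ x, Ev x = ev x := fun x => hEvrun x
  simp only [Function.comp_apply, fanoutFn_apply, fstF_boolPair, h1, h2, evalAlg, id]

end Support

/-- **`(C) → WordHard` given a polynomial-time word evaluator** (support statement `ClauseCImpWordHard` of the
skeleton, proved).  [folklore] -/
theorem clauseC_imp_wordHard :
    ∀ (M : WalkModel) (gen ans : List Bool → List Bool) (ev : List Bool → List Bool),
      PolyTimeComputable id id ev →
      (∀ n s w, ev (boolPair (inst gen n s) (encodingListNatBool.encode w)) =
          (M.endpoint (gen s) w).getD []) →
      Coherent M gen ans → ClauseC gen ans → WordHard M gen ans := by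
  intro M gen ans ev hev hspec _hcoh hC W hW
  have hA := hC (Support.evalAlg W ev) (Support.isPPT_evalAlg hW hev)
  refine hA.trans_eventually_abs_le (Eventually.of_forall fun n => ?_)
  simp only [Function.comp_apply]
  have hw0 : ∀ s, 0 ≤ W.pr id (inst gen n s) {w | M.endpoint (gen s) w = some (ans s)} :=
    fun s => RandAlg.pr_nonneg _ _ _ _
  have ha0 : ∀ s, 0 ≤ (Support.evalAlg W ev).pr id (boolPair (unaryEncodeNat n) (gen s)) {y | ans s <+: y} :=
    fun s => RandAlg.pr_nonneg _ _ _ _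
  rw [abs_of_nonneg (uniformAvg_nonneg hw0), abs_of_nonneg (uniformAvg_nonneg ha0)]
  refine SeedLaw.uniformAvg_mono fun s _ => ?_
  rw [RandAlg.pr_eq_uniformProb, RandAlg.pr_eq_uniformProb]
  refine CoinNormalisation.uniformProb_mono fun r hr => ?_
  simp only [Set.mem_setOf_eq] at hr ⊢
  have h := hspec n s (W.run (inst gen n s) r)
  simp only [inst] at h hr
  simp only [Support.evalAlg, h, hr, Option.getD_some]
  exact List.prefix_rfl

end Summit.QuantumAdvantage.QuantumAdvantage.Theorems.WbwObfuscatedGluedTrees.KnowledgeOfWalk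

end
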